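import Literature.MathematicalPhysics.QuantumFieldTheory.Balaban1983to89.Node00.OpsYSectE

/-!
# `Balaban1983to89.Node00.OpsYSectEPrintUnits` — T. Bałaban, *Propagators for lattice gauge theories in a background field*, Commun. Math. Phys. **99**
# (1985) 389–434 [Balaban1985BackgroundPropagators], Sect. E (3.156)–(3.158) p. 428 with the pairing conventions of (3.13) ∕ (3.16) pp. 392–393:
# THE PRINT-UNIT CURRENCY OF NODE 00's SECT. E LETTERS — the scale `η^{d+1} = L^{−k(d+1)}` of a member and the print-unit letters
# `η^{d+1}·Δ_k`, `η^{d+1}·C*Δ_kC`, `η^{−(d+1)}·C̃^{(k)}(Λ)`, `η^{−(d+1)}·C^{(k)}(Λ)`, with their dictionary to the flat letters of `OpsYSectE`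

statement-level construction with citation tags; proofs where landed; nothing here is a claim about the Yang–Mills mass gap, the continuum limit or OS.

WHY (dag-n08-d g31 CHECK-J, 2026-08-28; the convention word (v) of `Node00/OpsYSectELetters`).  Every adjoint of this lineage is FLAT (unweighted sums),
whereas print pairs `𝔸`-valued lattice functions with the measure factors `η^{d+1}` ((3.13): `⟨A,A′⟩ = η^{d+1}Σ_b …`) and `(L^jη)^{d+1}` on `Λ_j` ((3.16)),
`η = L^{−k}`, `L = ℓ+1`; r06's band `GlobalBand` puts the factor `L^{j(d+1)}(c_f/L^j)²` into the weights `x.w`.  Consequently the three terms of FILE 8's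
`deltaKY = (QG₁Q*)⁻¹ − a − D2J` sit in ONE convention and, AS A FORM, `η^{d+1}·Bᵀ(deltaKY U)B = ⟨B, Δ_k(U)B⟩` of (3.156): the PRECISION-type letters
(`QG1Qinv`, `aY`, `D2J`, `deltaKY`, `CsDeltaCY`) are print's × `η^{−(d+1)}`, the COVARIANCE-type letters (`CtildeKY`, `CkY`, inverses of the former) are
print's × `η^{(d+1)}`.  Member-UNIFORM two-sided class rows on these letters (the (3.24) doors at NODE 00, N06's at-record (3.132) ∕ (3.187) rows) must
therefore be read in PRINT units; this file NAMES that currency once so every consumer keys to the same letters.  Nothing of [Balaban1985BackgroundPropagators]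
is asserted; no consumer is modified; FILE 8's letters are used by name, not restated.

WHAT IS BUILT (all `def`s genuine functions of the background; every theorem proved, no `sorry`, standard axioms):
* §1 ★ `etaDY x : ℝ := ((((ℓ+1 : ℕ) : ℝ) ^ x.k)⁻¹) ^ (d+1)` — print's `η^{d+1}` at the member (`η = L^{−k}`; the literal token of dag-n08-d's repair (r1),
  so inline-scaled rows re-key by `rfl`); `etaDY_pos ∕ _nonneg ∕ _ne_zero ∕ _le_one`, `etaDY_eq_inv_pow` (`= (L^{k(d+1)})⁻¹`), `etaDY_eq_inv_cf_pow`
  (`= (c_f^{d+1})⁻¹` by `x.hcfk`), `etaDY_mul_inv ∕ etaDY_inv_mul`, the complex scalar `etaDℂY x := (etaDY x : ℂ)` faces.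
* §2 SCALARS THROUGH FILE 8's SECTORS (generic fibre): `isUnit_secCornerY_smul_iff` (the `S`-corner of `c • T` is a unit iff that of `T` is, `c ≠ 0`) and
  ★ `secInvY_smul` (`secInvY S (c • T) = c⁻¹ • secInvY S T`) — the corner of `c • T` factors through the block unit `cP_S + (1 − P_S)`, which commutes with
  the corner (Mathlib's `Ring.mul_inverse_rev'`, `Commute.isUnit_mul_iff`).
* §3 THE PRINT-UNIT LETTERS (`IBondOpY`): ★ `deltaKPY x 𝔏 𝔢 U := η^{d+1} • deltaKY x 𝔏 𝔢 U` (print's `Δ_k(U)` of (3.156), flat-form matrix),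
  `CsDeltaCPY := η^{d+1} • CsDeltaCY` (print's `C*Δ_kC` of (3.157)), ★ `CtildeKPY := η^{−(d+1)} • CtildeKY` (print's `C̃^{(k)}(Λ;U)` of (3.158)),
  ★ `CkPY := η^{−(d+1)} • CkY` (print's `C^{(k)}(Λ;U)`), and their DICTIONARY: `…_apply` (operator and entry level), `norm_…_apply`
  (`‖deltaKPY … U B c‖ = etaDY x * ‖deltaKY … U B c‖` and the three others, plus the converse readings `norm_deltaKY_apply_eq ∕ norm_CkY_apply_eq`),
  `deltaKPY_eq_sub` (the three scaled terms), `deltaKPY_one`, `CsDeltaCPY_eq` (`= C*·deltaKPY·C`), `CkPY_eq` (`= C·CtildeKPY·C*`), ★★ `CtildeKPY_eq_secInvY :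
  CtildeKPY U = secInvY Λ̃ (CsDeltaCPY U)` (print-unit covariance = sector inverse of print-unit precision — (3.156)–(3.158) hold in print units verbatim),
  `isUnit_secCornerY_CsDeltaCPY_iff`, the inverse pair `CsDeltaCPY_mul_CtildeKPY ∕ CtildeKPY_mul_CsDeltaCPY = P_Λ̃` under FILE 8's unit hypothesis, the
  Dirichlet ∕ support faces, and the flat letters recovered (`deltaKY_eq_smul_deltaKPY ∕ CkY_eq_smul_CkPY`).

HONEST MARGINS. (i) The dictionary «flat = print × η^{∓(d+1)}» is the READING recorded in `OpsYSectELetters` word (v) (pairings (3.13) ∕ (3.16)); print's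
weighted pairing is not a typed object of the tree, so the dictionary is carried by these definitions and their docstrings, not by a theorem against a
printed form.  (ii) At levels `j < k` the operator-level row factor of word (v) is `diag(L^{j(d+1)})`, not a scalar; the scalar `η^{d+1}` is the FORM-level
factor (all levels) and the operator-level factor on the top level `Λ_k ⊇ Λ` — the carrier of (3.156)–(3.158) (`secΛY`, `inΛY_top`).  (iii) Real-scalar
readings of the entries (`(r : ℂ) • v = r • v`) are Mathlib's `Complex.coe_smul`; this file states complex-scalar and norm faces only, so no `ℝ`-module
instance on the fibre is chosen here.  Net new unproved facts: 0.
-/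

noncomputable section

namespace Literature.MathematicalPhysics.QuantumFieldTheory.Balaban1983to89.Node00

open B6KLevelCensusIndexV1 (KIdx)
open B9PinMembersKLevelV1 (MemberY)
open B9PinGeometryKLevelV1 (inΛY)

variable {d ℓ : ℕ} {hd : 1 ≤ d + 1} {hL : Odd (ℓ + 1) ∧ 1 < ℓ + 1} {b₀ b₁ : ℝ} {Mstar : ℕ}

/-! ## §1 The scale `η^{d+1}` of a member -/

section Scale

/-- ★ **print's measure factor `η^{d+1}` at the member** (`η = L^{−k}` the lattice spacing of `T_η = T^{(k)}_{L^{−k}}`, `L = ℓ+1`): the scalar converting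
NODE 00's flat precision-type letters to print's units ((3.13) `⟨A,A′⟩ = η^{d+1}Σ …`; at the top level `(L^kη)^{d+1} = 1` in (3.16)).  Written as the literal
token `((L^k)⁻¹)^{d+1}`. [cite: Balaban1985BackgroundPropagators, (3.13) p.392, (3.16) p.393, (3.156) p.428, dictionary] -/
def etaDY (x : MemberY d ℓ hd hL b₀ b₁ Mstar) : ℝ := ((((ℓ + 1 : ℕ) : ℝ) ^ x.k)⁻¹) ^ (d + 1)

variable (x : MemberY d ℓ hd hL b₀ b₁ Mstar)

/-- `η^{d+1}` unfolded. [cite: Balaban1985BackgroundPropagators, (3.13) p.392, bookkeeping] -/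
theorem etaDY_def : etaDY x = ((((ℓ + 1 : ℕ) : ℝ) ^ x.k)⁻¹) ^ (d + 1) := rfl

/-- plumbing. [folklore] -/
private theorem L_pos : 0 < ((ℓ + 1 : ℕ) : ℝ) := by exact_mod_cast Nat.succ_pos ℓ

/-- plumbing. [folklore] -/
private theorem one_le_L : (1 : ℝ) ≤ ((ℓ + 1 : ℕ) : ℝ) := by exact_mod_cast Nat.succ_le_succ (Nat.zero_le ℓ)

/-- `η^{d+1} > 0`. [cite: Balaban1985BackgroundPropagators, (3.13) p.392, bookkeeping] -/
theorem etaDY_pos : 0 < etaDY x := pow_pos (inv_pos.mpr (pow_pos L_pos _)) _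

/-- `η^{d+1} ≥ 0`. [cite: Balaban1985BackgroundPropagators, (3.13) p.392, bookkeeping] -/
theorem etaDY_nonneg : 0 ≤ etaDY x := (etaDY_pos x).le

/-- `η^{d+1} ≠ 0`. [cite: Balaban1985BackgroundPropagators, (3.13) p.392, bookkeeping] -/
theorem etaDY_ne_zero : etaDY x ≠ 0 := (etaDY_pos x).ne'

/-- `η^{d+1} ≤ 1` (`L ≥ 1`). [cite: Balaban1985BackgroundPropagators, (3.13) p.392, bookkeeping] -/
theorem etaDY_le_one : etaDY x ≤ 1 :=
  pow_le_one₀ (inv_nonneg.mpr (pow_pos L_pos _).le) (inv_le_one_of_one_le₀ (one_le_pow₀ one_le_L))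

/-- `η^{d+1} = (L^{k(d+1)})⁻¹`. [cite: Balaban1985BackgroundPropagators, (3.13) p.392, bookkeeping] -/
theorem etaDY_eq_inv_pow : etaDY x = ((((ℓ + 1 : ℕ) : ℝ) ^ (x.k * (d + 1))))⁻¹ := by
  rw [etaDY, inv_pow, pow_mul]

/-- `η^{d+1} = (c_f^{d+1})⁻¹` with the member's unit `c_f = L^k` (`x.hcfk`). [cite: Balaban1985BackgroundPropagators, (3.13) p.392, Thm 3.14 p.426 (the k-th step units), bookkeeping] -/
theorem etaDY_eq_inv_cf_pow : etaDY x = (x.cf ^ (d + 1))⁻¹ := by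
  rw [etaDY, inv_pow, x.hcfk]

/-- `η^{d+1}·η^{−(d+1)} = 1`. [cite: Balaban1985BackgroundPropagators, (3.13) p.392, bookkeeping] -/
theorem etaDY_mul_inv : etaDY x * (etaDY x)⁻¹ = 1 := mul_inv_cancel₀ (etaDY_ne_zero x)

/-- `η^{−(d+1)}·η^{d+1} = 1`. [cite: Balaban1985BackgroundPropagators, (3.13) p.392, bookkeeping] -/
theorem etaDY_inv_mul : (etaDY x)⁻¹ * etaDY x = 1 := inv_mul_cancel₀ (etaDY_ne_zero x)

/-- the scale as a complex scalar is nonzero. [cite: Balaban1985BackgroundPropagators, (3.13) p.392, bookkeeping] -/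
theorem etaDY_coe_ne_zero : ((etaDY x : ℝ) : ℂ) ≠ 0 := by exact_mod_cast etaDY_ne_zero x

/-- `‖(η^{d+1} : ℂ)‖ = η^{d+1}`. [cite: Balaban1985BackgroundPropagators, (3.13) p.392, bookkeeping] -/
theorem norm_etaDY_coe : ‖((etaDY x : ℝ) : ℂ)‖ = etaDY x := by
  rw [Complex.norm_real, Real.norm_of_nonneg (etaDY_nonneg x)]

/-- `‖(η^{d+1} : ℂ)⁻¹‖ = η^{−(d+1)}`. [cite: Balaban1985BackgroundPropagators, (3.13) p.392, bookkeeping] -/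
theorem norm_etaDY_coe_inv : ‖(((etaDY x : ℝ) : ℂ))⁻¹‖ = (etaDY x)⁻¹ := by
  rw [norm_inv, norm_etaDY_coe]

/-- `(η^{d+1} : ℂ)⁻¹ = ((η^{d+1})⁻¹ : ℝ)` as complex numbers. [cite: Balaban1985BackgroundPropagators, (3.13) p.392, bookkeeping] -/
theorem etaDY_coe_inv : (((etaDY x : ℝ) : ℂ))⁻¹ = (((etaDY x)⁻¹ : ℝ) : ℂ) := (Complex.ofReal_inv _).symm

end Scale

/-! ## §2 Scalars through sectors and the sector inverse -/

section SectorSmul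

variable {𝔸 : Type} [NormedRing 𝔸] [NormedAlgebra ℂ 𝔸]

/-- the block scalar `c P_S + (1 − P_S)` (scales the `S`-supported functions by `c`, fixes the `Sᶜ`-supported ones). [folklore] -/
private def diagY {X : Type} (S : X → Prop) (c : ℂ) : Module.End ℂ (X → 𝔸) := c • secY 𝔸 S + (1 - secY 𝔸 S)

/-- plumbing. [folklore] -/
private theorem one_sub_secY_mul_secY {X : Type} (S : X → Prop) : (1 - secY 𝔸 S) * secY 𝔸 S = 0 := by
  rw [sub_mul, one_mul, secY_idem, sub_self]

/-- plumbing. [folklore] -/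
private theorem secY_mul_one_sub_secY {X : Type} (S : X → Prop) : secY 𝔸 S * (1 - secY 𝔸 S) = 0 := by
  rw [mul_sub, mul_one, secY_idem, sub_self]

/-- plumbing. [folklore] -/
private theorem one_sub_secY_idem {X : Type} (S : X → Prop) :
    (1 - secY 𝔸 S) * (1 - secY 𝔸 S) = (1 - secY 𝔸 S : Module.End ℂ (X → 𝔸)) := by
  rw [sub_mul, one_mul, secY_mul_one_sub_secY, sub_zero]

/-- `K(c•T) = (cP + (1−P))·K(T)`. [folklore] -/
private theorem secCornerY_smul_eq {X : Type} (S : X → Prop) (c : ℂ) (T : Module.End ℂ (X → 𝔸)) :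
    secCornerY 𝔸 S (c • T) = diagY S c * secCornerY 𝔸 S T := by
  have h1 : c • secY 𝔸 S * (secY 𝔸 S * T * secY 𝔸 S) = secY 𝔸 S * (c • T) * secY 𝔸 S := by
    rw [smul_mul_assoc, ← mul_assoc, ← mul_assoc, secY_idem, mul_smul_comm, smul_mul_assoc]
  have h2 : c • secY 𝔸 S * (1 - secY 𝔸 S) = (0 : Module.End ℂ (X → 𝔸)) := by rw [smul_mul_assoc, secY_mul_one_sub_secY, smul_zero]
  have h3 : (1 - secY 𝔸 S) * (secY 𝔸 S * T * secY 𝔸 S) = (0 : Module.End ℂ (X → 𝔸)) := by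
    rw [← mul_assoc, ← mul_assoc, one_sub_secY_mul_secY, zero_mul, zero_mul]
  rw [secCornerY, secCornerY, diagY, add_mul, mul_add, mul_add, h1, h2, h3, one_sub_secY_idem, add_zero, zero_add]

/-- `K(c•T) = K(T)·(cP + (1−P))`. [folklore] -/
private theorem secCornerY_smul_eq' {X : Type} (S : X → Prop) (c : ℂ) (T : Module.End ℂ (X → 𝔸)) :
    secCornerY 𝔸 S (c • T) = secCornerY 𝔸 S T * diagY S c := by
  have h1 : secY 𝔸 S * T * secY 𝔸 S * (c • secY 𝔸 S) = secY 𝔸 S * (c • T) * secY 𝔸 S := by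
    rw [mul_smul_comm, mul_secY_mul_secY, mul_smul_comm, smul_mul_assoc]
  have h2 : secY 𝔸 S * T * secY 𝔸 S * (1 - secY 𝔸 S) = (0 : Module.End ℂ (X → 𝔸)) := by rw [mul_assoc, secY_mul_one_sub_secY, mul_zero]
  have h3 : (1 - secY 𝔸 S) * (c • secY 𝔸 S) = (0 : Module.End ℂ (X → 𝔸)) := by rw [mul_smul_comm, one_sub_secY_mul_secY, smul_zero]
  rw [secCornerY, secCornerY, diagY, mul_add, add_mul, add_mul, h1, h2, h3, one_sub_secY_idem, zero_add, add_zero]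

/-- plumbing. [folklore] -/
private theorem diagY_mul_diagY {X : Type} (S : X → Prop) (c c' : ℂ) :
    diagY (𝔸 := 𝔸) S c * diagY S c' = diagY S (c * c') := by
  have h1 : c • secY 𝔸 S * (c' • secY 𝔸 S) = (c * c') • secY 𝔸 S := by
    rw [smul_mul_assoc, mul_smul_comm, secY_idem, smul_smul]
  have h2 : c • secY 𝔸 S * (1 - secY 𝔸 S) = (0 : Module.End ℂ (X → 𝔸)) := by rw [smul_mul_assoc, secY_mul_one_sub_secY, smul_zero]
  have h3 : (1 - secY 𝔸 S) * (c' • secY 𝔸 S) = (0 : Module.End ℂ (X → 𝔸)) := by rw [mul_smul_comm, one_sub_secY_mul_secY, smul_zero]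
  rw [diagY, diagY, diagY, add_mul, mul_add, mul_add, h1, h2, h3, one_sub_secY_idem, add_zero, zero_add]

/-- plumbing. [folklore] -/
private theorem diagY_one {X : Type} (S : X → Prop) : diagY (𝔸 := 𝔸) S 1 = 1 := by
  rw [diagY, one_smul, add_sub_cancel]

/-- the block scalar as a unit (for `c ≠ 0`). [folklore] -/
private def diagUnitY {X : Type} (S : X → Prop) (c : ℂ) (hc : c ≠ 0) : (Module.End ℂ (X → 𝔸))ˣ where
  val := diagY S c
  inv := diagY S c⁻¹
  val_inv := by rw [diagY_mul_diagY, mul_inv_cancel₀ hc, diagY_one]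
  inv_val := by rw [diagY_mul_diagY, inv_mul_cancel₀ hc, diagY_one]

/-- plumbing. [folklore] -/
private theorem inverse_diagY {X : Type} (S : X → Prop) {c : ℂ} (hc : c ≠ 0) :
    Ring.inverse (diagY (𝔸 := 𝔸) S c) = diagY S c⁻¹ := by
  rw [show diagY (𝔸 := 𝔸) S c = ((diagUnitY S c hc : (Module.End ℂ (X → 𝔸))ˣ) : Module.End ℂ (X → 𝔸)) from rfl, Ring.inverse_unit]
  rfl

/-- plumbing. [folklore] -/
private theorem commute_diagY_secCornerY {X : Type} (S : X → Prop) (c : ℂ) (T : Module.End ℂ (X → 𝔸)) :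
    Commute (diagY S c) (secCornerY 𝔸 S T) := by
  show diagY S c * secCornerY 𝔸 S T = secCornerY 𝔸 S T * diagY S c
  rw [← secCornerY_smul_eq, secCornerY_smul_eq']

/-- ★ **a scalar passes through the corner's invertibility**: the `S`-corner of `c • T` is a unit iff that of `T` is (`c ≠ 0`).
[cite: Balaban1985BackgroundPropagators, (3.158) p.428, bookkeeping] -/
theorem isUnit_secCornerY_smul_iff {X : Type} (S : X → Prop) {c : ℂ} (hc : c ≠ 0) (T : Module.End ℂ (X → 𝔸)) :
    IsUnit (secCornerY 𝔸 S (c • T)) ↔ IsUnit (secCornerY 𝔸 S T) := by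
  rw [secCornerY_smul_eq, (commute_diagY_secCornerY S c T).isUnit_mul_iff]
  exact ⟨fun h => h.2, fun h => ⟨(diagUnitY S c hc).isUnit, h⟩⟩

/-- ★ **a scalar passes through the sector inverse inverted**: `secInvY S (c • T) = c⁻¹ • secInvY S T` (`c ≠ 0`; both sides `0` when the corner is not a unit).
[cite: Balaban1985BackgroundPropagators, (3.158) p.428, bookkeeping] -/
theorem secInvY_smul {X : Type} (S : X → Prop) {c : ℂ} (hc : c ≠ 0) (T : Module.End ℂ (X → 𝔸)) :
    secInvY 𝔸 S (c • T) = c⁻¹ • secInvY 𝔸 S T := by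
  have hD : Ring.inverse (diagY (𝔸 := 𝔸) S c) * secY 𝔸 S = c⁻¹ • secY 𝔸 S := by
    rw [inverse_diagY S hc, diagY, add_mul, smul_mul_assoc, secY_idem, one_sub_secY_mul_secY, add_zero]
  rw [secInvY, secInvY, secCornerY_smul_eq, Ring.mul_inverse_rev' (commute_diagY_secCornerY S c T), mul_assoc, mul_assoc, hD, mul_smul_comm,
    mul_smul_comm, ← mul_assoc]

end SectorSmul

/-! ## §3 The print-unit letters and their dictionary -/

section PrintLetters

variable {𝔸 : Type} [NormedRing 𝔸] [NormedAlgebra ℂ 𝔸] [CompleteSpace 𝔸]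
variable (x : MemberY d ℓ hd hL b₀ b₁ Mstar) (𝔏 : CovLettersY 𝔸 x) (𝔢 : SectELettersY 𝔸 x)

/-- ★ **print's `Δ_k(U)` of (3.156) in print units**: `η^{d+1} • deltaKY` — the flat matrix of the quadratic form `⟨B, Δ_k(U)B⟩` of (3.156) with print's
measure factor restored (word (v): `⟨B,(QG₁Q*)⁻¹B⟩_𝔅 = η^{d+1}·Bᵀ(QG1Qinv U)B`, `a⟨B,B⟩_𝔅 = η^{d+1}·Bᵀ(aY)B`).
[cite: Balaban1985BackgroundPropagators, (3.156) p.428, (3.13) p.392, (3.16) p.393, dictionary] -/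
def deltaKPY : IBondOpY 𝔸 x.toKIdx := fun U => ((etaDY x : ℝ) : ℂ) • deltaKY x 𝔏 𝔢 U

/-- **print's `C*Δ_kC` of (3.157) in print units**: `η^{d+1} • CsDeltaCY`. [cite: Balaban1985BackgroundPropagators, (3.157) p.428, dictionary] -/
def CsDeltaCPY : IBondOpY 𝔸 x.toKIdx := fun U => ((etaDY x : ℝ) : ℂ) • CsDeltaCY x 𝔏 𝔢 U

/-- ★ **print's `C̃^{(k)}(Λ; U) = (C*Δ_kC)⁻¹` of (3.158) in print units**: `η^{−(d+1)} • CtildeKY` (a covariance-type letter: the inverse scale).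
[cite: Balaban1985BackgroundPropagators, (3.158) p.428, dictionary] -/
def CtildeKPY : IBondOpY 𝔸 x.toKIdx := fun U => (((etaDY x : ℝ) : ℂ))⁻¹ • CtildeKY x 𝔏 𝔢 U

/-- ★★ **print's unit-lattice propagator `C^{(k)}(Λ; U) = C C̃^{(k)}(Λ) C*` of (3.158) in print units**: `η^{−(d+1)} • CkY` — the covariance of print's
Gaussian `dμ_{C^{(k)}(Λ)}`. [cite: Balaban1985BackgroundPropagators, (3.158) p.428, Thm 3.15 p.432, dictionary] -/
def CkPY : IBondOpY 𝔸 x.toKIdx := fun U => (((etaDY x : ℝ) : ℂ))⁻¹ • CkY x 𝔏 𝔢 U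

variable {x 𝔏 𝔢}

/-- `η^{d+1}Δ_k` unfolded (operator level). [cite: Balaban1985BackgroundPropagators, (3.156) p.428, bookkeeping] -/
theorem deltaKPY_apply (U : CfgY 𝔸 x.toKIdx) : deltaKPY x 𝔏 𝔢 U = ((etaDY x : ℝ) : ℂ) • deltaKY x 𝔏 𝔢 U := rfl

/-- `η^{d+1}C*Δ_kC` unfolded. [cite: Balaban1985BackgroundPropagators, (3.157) p.428, bookkeeping] -/
theorem CsDeltaCPY_apply (U : CfgY 𝔸 x.toKIdx) : CsDeltaCPY x 𝔏 𝔢 U = ((etaDY x : ℝ) : ℂ) • CsDeltaCY x 𝔏 𝔢 U := rfl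

/-- `η^{−(d+1)}C̃^{(k)}(Λ)` unfolded. [cite: Balaban1985BackgroundPropagators, (3.158) p.428, bookkeeping] -/
theorem CtildeKPY_apply (U : CfgY 𝔸 x.toKIdx) : CtildeKPY x 𝔏 𝔢 U = (((etaDY x : ℝ) : ℂ))⁻¹ • CtildeKY x 𝔏 𝔢 U := rfl

/-- `η^{−(d+1)}C^{(k)}(Λ)` unfolded. [cite: Balaban1985BackgroundPropagators, (3.158) p.428, bookkeeping] -/
theorem CkPY_apply (U : CfgY 𝔸 x.toKIdx) : CkPY x 𝔏 𝔢 U = (((etaDY x : ℝ) : ℂ))⁻¹ • CkY x 𝔏 𝔢 U := rfl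

/-- entry level: `(η^{d+1}Δ_k B)(c) = η^{d+1}·(Δ_k B)(c)`. [cite: Balaban1985BackgroundPropagators, (3.156) p.428, bookkeeping] -/
theorem deltaKPY_apply_apply (U : CfgY 𝔸 x.toKIdx) (B : IBondY x.toKIdx → 𝔸) (c : IBondY x.toKIdx) :
    deltaKPY x 𝔏 𝔢 U B c = ((etaDY x : ℝ) : ℂ) • deltaKY x 𝔏 𝔢 U B c := rfl

/-- entry level for `η^{d+1}C*Δ_kC`. [cite: Balaban1985BackgroundPropagators, (3.157) p.428, bookkeeping] -/
theorem CsDeltaCPY_apply_apply (U : CfgY 𝔸 x.toKIdx) (B : IBondY x.toKIdx → 𝔸) (c : IBondY x.toKIdx) :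
    CsDeltaCPY x 𝔏 𝔢 U B c = ((etaDY x : ℝ) : ℂ) • CsDeltaCY x 𝔏 𝔢 U B c := rfl

/-- entry level for `η^{−(d+1)}C̃^{(k)}(Λ)`. [cite: Balaban1985BackgroundPropagators, (3.158) p.428, bookkeeping] -/
theorem CtildeKPY_apply_apply (U : CfgY 𝔸 x.toKIdx) (B : IBondY x.toKIdx → 𝔸) (c : IBondY x.toKIdx) :
    CtildeKPY x 𝔏 𝔢 U B c = (((etaDY x : ℝ) : ℂ))⁻¹ • CtildeKY x 𝔏 𝔢 U B c := rfl

/-- entry level for `η^{−(d+1)}C^{(k)}(Λ)`. [cite: Balaban1985BackgroundPropagators, (3.158) p.428, bookkeeping] -/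
theorem CkPY_apply_apply (U : CfgY 𝔸 x.toKIdx) (B : IBondY x.toKIdx → 𝔸) (c : IBondY x.toKIdx) :
    CkPY x 𝔏 𝔢 U B c = (((etaDY x : ℝ) : ℂ))⁻¹ • CkY x 𝔏 𝔢 U B c := rfl

/-- ★ **norm dictionary**: `‖(η^{d+1}Δ_k B)(c)‖ = η^{d+1}·‖(Δ_k B)(c)‖`. [cite: Balaban1985BackgroundPropagators, (3.156) p.428, (3.13) p.392, bookkeeping] -/
theorem norm_deltaKPY_apply (U : CfgY 𝔸 x.toKIdx) (B : IBondY x.toKIdx → 𝔸) (c : IBondY x.toKIdx) :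
    ‖deltaKPY x 𝔏 𝔢 U B c‖ = etaDY x * ‖deltaKY x 𝔏 𝔢 U B c‖ := by
  rw [deltaKPY_apply_apply, norm_smul, norm_etaDY_coe]

/-- `‖(η^{d+1}C*Δ_kC B)(c)‖ = η^{d+1}·‖(C*Δ_kC B)(c)‖`. [cite: Balaban1985BackgroundPropagators, (3.157) p.428, bookkeeping] -/
theorem norm_CsDeltaCPY_apply (U : CfgY 𝔸 x.toKIdx) (B : IBondY x.toKIdx → 𝔸) (c : IBondY x.toKIdx) :
    ‖CsDeltaCPY x 𝔏 𝔢 U B c‖ = etaDY x * ‖CsDeltaCY x 𝔏 𝔢 U B c‖ := by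
  rw [CsDeltaCPY_apply_apply, norm_smul, norm_etaDY_coe]

/-- ★ `‖(η^{−(d+1)}C̃^{(k)} B)(c)‖ = η^{−(d+1)}·‖(C̃^{(k)} B)(c)‖`. [cite: Balaban1985BackgroundPropagators, (3.158) p.428, bookkeeping] -/
theorem norm_CtildeKPY_apply (U : CfgY 𝔸 x.toKIdx) (B : IBondY x.toKIdx → 𝔸) (c : IBondY x.toKIdx) :
    ‖CtildeKPY x 𝔏 𝔢 U B c‖ = (etaDY x)⁻¹ * ‖CtildeKY x 𝔏 𝔢 U B c‖ := by
  rw [CtildeKPY_apply_apply, norm_smul, norm_etaDY_coe_inv]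

/-- ★ `‖(η^{−(d+1)}C^{(k)} B)(c)‖ = η^{−(d+1)}·‖(C^{(k)} B)(c)‖` — print's (3.187) for `C^{(k)}(Λ)` reads on the flat `CkY` with the factor `η^{d+1}`.
[cite: Balaban1985BackgroundPropagators, (3.158) p.428, (3.187) p.432, bookkeeping] -/
theorem norm_CkPY_apply (U : CfgY 𝔸 x.toKIdx) (B : IBondY x.toKIdx → 𝔸) (c : IBondY x.toKIdx) :
    ‖CkPY x 𝔏 𝔢 U B c‖ = (etaDY x)⁻¹ * ‖CkY x 𝔏 𝔢 U B c‖ := by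
  rw [CkPY_apply_apply, norm_smul, norm_etaDY_coe_inv]

/-- the converse reading: `‖(Δ_k B)(c)‖ = η^{−(d+1)}·‖(η^{d+1}Δ_k B)(c)‖`. [cite: Balaban1985BackgroundPropagators, (3.156) p.428, bookkeeping] -/
theorem norm_deltaKY_apply_eq (U : CfgY 𝔸 x.toKIdx) (B : IBondY x.toKIdx → 𝔸) (c : IBondY x.toKIdx) :
    ‖deltaKY x 𝔏 𝔢 U B c‖ = (etaDY x)⁻¹ * ‖deltaKPY x 𝔏 𝔢 U B c‖ := by
  rw [norm_deltaKPY_apply, ← mul_assoc, etaDY_inv_mul, one_mul]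

/-- the converse reading for `C^{(k)}`: `‖(C^{(k)} B)(c)‖ = η^{d+1}·‖(η^{−(d+1)}C^{(k)} B)(c)‖`. [cite: Balaban1985BackgroundPropagators, (3.158) p.428, bookkeeping] -/
theorem norm_CkY_apply_eq (U : CfgY 𝔸 x.toKIdx) (B : IBondY x.toKIdx → 𝔸) (c : IBondY x.toKIdx) :
    ‖CkY x 𝔏 𝔢 U B c‖ = etaDY x * ‖CkPY x 𝔏 𝔢 U B c‖ := by
  rw [norm_CkPY_apply, ← mul_assoc, etaDY_mul_inv, one_mul]

/-- ★ **(3.156) in print units, term by term**: `η^{d+1}Δ_k(U) = η^{d+1}(QG₁Q*)⁻¹(U) − η^{d+1}a − η^{d+1}D2J(U)`.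
[cite: Balaban1985BackgroundPropagators, (3.156) p.428, bookkeeping] -/
theorem deltaKPY_eq_sub (U : CfgY 𝔸 x.toKIdx) :
    deltaKPY x 𝔏 𝔢 U = ((etaDY x : ℝ) : ℂ) • 𝔏.QG1Qinv U - ((etaDY x : ℝ) : ℂ) • aY x.toKIdx - ((etaDY x : ℝ) : ℂ) • 𝔢.D2J U := by
  rw [deltaKPY_apply, deltaKY_apply, smul_sub, smul_sub]

/-- at `U = 1`: `η^{d+1}Δ_k(1) = η^{d+1}(QG₁Q*)⁻¹(1) − η^{d+1}a`. [cite: Balaban1985BackgroundPropagators, (3.156) p.428, (3.117) p.419 (J = 0 at U = 1), bookkeeping] -/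
theorem deltaKPY_one :
    deltaKPY x 𝔏 𝔢 (fun _ _ => 1) = ((etaDY x : ℝ) : ℂ) • 𝔏.QG1Qinv (fun _ _ => 1) - ((etaDY x : ℝ) : ℂ) • aY x.toKIdx := by
  rw [deltaKPY_apply, deltaKY_one, smul_sub]

/-- ★ **(3.157) in print units**: `η^{d+1}C*Δ_kC = C*·(η^{d+1}Δ_k)·C` (the parametrisation letters carry no unit).
[cite: Balaban1985BackgroundPropagators, (3.157) p.428, bookkeeping] -/
theorem CsDeltaCPY_eq (U : CfgY 𝔸 x.toKIdx) : CsDeltaCPY x 𝔏 𝔢 U = elimCtΛY x 𝔢 U * deltaKPY x 𝔏 𝔢 U * elimCΛY x 𝔢 U := by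
  rw [CsDeltaCPY_apply, deltaKPY_apply, CsDeltaCY, mul_smul_comm, smul_mul_assoc]

/-- ★ **(3.158), second equality, in print units**: `η^{−(d+1)}C^{(k)}(Λ) = C·(η^{−(d+1)}C̃^{(k)}(Λ))·C*`.
[cite: Balaban1985BackgroundPropagators, (3.158) p.428, bookkeeping] -/
theorem CkPY_eq (U : CfgY 𝔸 x.toKIdx) : CkPY x 𝔏 𝔢 U = elimCΛY x 𝔢 U * CtildeKPY x 𝔏 𝔢 U * elimCtΛY x 𝔢 U := by
  rw [CkPY_apply, CtildeKPY_apply, CkY_apply, mul_smul_comm, smul_mul_assoc]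

/-- ★★ **(3.158), first equality, in print units**: `η^{−(d+1)}C̃^{(k)}(Λ; U) = (η^{d+1}C*Δ_kC)⁻¹` on the `Λ̃`-functions — the print-unit covariance IS the
sector inverse of the print-unit precision (the scale passes through `secInvY` inverted), so (3.156)–(3.158) hold VERBATIM in print units.
[cite: Balaban1985BackgroundPropagators, (3.158) p.428] -/
theorem CtildeKPY_eq_secInvY (U : CfgY 𝔸 x.toKIdx) : CtildeKPY x 𝔏 𝔢 U = secInvY 𝔸 𝔢.LamT (CsDeltaCPY x 𝔏 𝔢 U) := by
  rw [CtildeKPY_apply, CsDeltaCPY_apply, secInvY_smul _ (etaDY_coe_ne_zero x), CtildeKY]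

/-- the print-unit precision's `Λ̃`-corner is a unit iff the flat one is (FILE 8's hypothesis of `CsDeltaCY_mul_CtildeKY`, unchanged).
[cite: Balaban1985BackgroundPropagators, (3.158) p.428 (positivity of C*Δ_kC), bookkeeping] -/
theorem isUnit_secCornerY_CsDeltaCPY_iff (U : CfgY 𝔸 x.toKIdx) :
    IsUnit (secCornerY 𝔸 𝔢.LamT (CsDeltaCPY x 𝔏 𝔢 U)) ↔ IsUnit (secCornerY 𝔸 𝔢.LamT (CsDeltaCY x 𝔏 𝔢 U)) :=
  isUnit_secCornerY_smul_iff _ (etaDY_coe_ne_zero x) _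

/-- ★ **(3.158) as an identity in print units (right inverse)**: `(η^{d+1}C*Δ_kC)·(η^{−(d+1)}C̃^{(k)}) = P_Λ̃` under FILE 8's unit hypothesis.
[cite: Balaban1985BackgroundPropagators, (3.158) p.428] -/
theorem CsDeltaCPY_mul_CtildeKPY (U : CfgY 𝔸 x.toKIdx) (h : IsUnit (secCornerY 𝔸 𝔢.LamT (CsDeltaCY x 𝔏 𝔢 U))) :
    CsDeltaCPY x 𝔏 𝔢 U * CtildeKPY x 𝔏 𝔢 U = secY 𝔸 𝔢.LamT := by
  rw [CsDeltaCPY_apply, CtildeKPY_apply, smul_mul_assoc, mul_smul_comm, smul_smul, mul_inv_cancel₀ (etaDY_coe_ne_zero x), one_smul,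
    CsDeltaCY_mul_CtildeKY U h]

/-- ★ **… (left inverse)**: `(η^{−(d+1)}C̃^{(k)})·(η^{d+1}C*Δ_kC) = P_Λ̃`. [cite: Balaban1985BackgroundPropagators, (3.158) p.428] -/
theorem CtildeKPY_mul_CsDeltaCPY (U : CfgY 𝔸 x.toKIdx) (h : IsUnit (secCornerY 𝔸 𝔢.LamT (CsDeltaCY x 𝔏 𝔢 U))) :
    CtildeKPY x 𝔏 𝔢 U * CsDeltaCPY x 𝔏 𝔢 U = secY 𝔸 𝔢.LamT := by
  rw [CsDeltaCPY_apply, CtildeKPY_apply, smul_mul_assoc, mul_smul_comm, smul_smul, inv_mul_cancel₀ (etaDY_coe_ne_zero x), one_smul,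
    CtildeKY_mul_CsDeltaCY U h]

/-- Dirichlet (left) in print units: `P_Λ·(η^{−(d+1)}C^{(k)}(Λ)) = η^{−(d+1)}C^{(k)}(Λ)`. [cite: Balaban1985BackgroundPropagators, p.427 (Dirichlet outside Λ), (3.158) p.428] -/
theorem secΛY_mul_CkPY (U : CfgY 𝔸 x.toKIdx) : secΛY 𝔸 x * CkPY x 𝔏 𝔢 U = CkPY x 𝔏 𝔢 U := by
  rw [CkPY_apply, mul_smul_comm, secΛY_mul_CkY]

/-- Dirichlet (right) in print units. [cite: Balaban1985BackgroundPropagators, p.427 (Dirichlet outside Λ), (3.158) p.428] -/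
theorem CkPY_mul_secΛY (U : CfgY 𝔸 x.toKIdx) : CkPY x 𝔏 𝔢 U * secΛY 𝔸 x = CkPY x 𝔏 𝔢 U := by
  rw [CkPY_apply, smul_mul_assoc, CkY_mul_secΛY]

/-- `η^{−(d+1)}C̃^{(k)}(Λ)` is supported in `Λ̃` (left). [cite: Balaban1985BackgroundPropagators, (3.158) p.428] -/
theorem secY_mul_CtildeKPY (U : CfgY 𝔸 x.toKIdx) : secY 𝔸 𝔢.LamT * CtildeKPY x 𝔏 𝔢 U = CtildeKPY x 𝔏 𝔢 U := by
  rw [CtildeKPY_apply, mul_smul_comm, secY_mul_CtildeKY]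

/-- `η^{−(d+1)}C̃^{(k)}(Λ)` is supported in `Λ̃` (right). [cite: Balaban1985BackgroundPropagators, (3.158) p.428] -/
theorem CtildeKPY_mul_secY (U : CfgY 𝔸 x.toKIdx) : CtildeKPY x 𝔏 𝔢 U * secY 𝔸 𝔢.LamT = CtildeKPY x 𝔏 𝔢 U := by
  rw [CtildeKPY_apply, smul_mul_assoc, CtildeKY_mul_secY]

/-- `η^{d+1}C*Δ_kC` is an operator on the `Λ̃`-functions. [cite: Balaban1985BackgroundPropagators, (3.157) p.428, bookkeeping] -/
theorem secY_mul_CsDeltaCPY_mul_secY (U : CfgY 𝔸 x.toKIdx) :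
    secY 𝔸 𝔢.LamT * CsDeltaCPY x 𝔏 𝔢 U * secY 𝔸 𝔢.LamT = CsDeltaCPY x 𝔏 𝔢 U := by
  rw [CsDeltaCPY_apply, mul_smul_comm, smul_mul_assoc, secY_mul_CsDeltaCY_mul_secY]

/-- the flat letters recovered: `Δ_k^{flat} = η^{−(d+1)} • (η^{d+1}Δ_k)`. [cite: Balaban1985BackgroundPropagators, (3.156) p.428, bookkeeping] -/
theorem deltaKY_eq_smul_deltaKPY (U : CfgY 𝔸 x.toKIdx) : deltaKY x 𝔏 𝔢 U = (((etaDY x : ℝ) : ℂ))⁻¹ • deltaKPY x 𝔏 𝔢 U := by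
  rw [deltaKPY_apply, smul_smul, inv_mul_cancel₀ (etaDY_coe_ne_zero x), one_smul]

/-- the flat propagator recovered: `C^{(k),flat} = η^{d+1} • (η^{−(d+1)}C^{(k)})`. [cite: Balaban1985BackgroundPropagators, (3.158) p.428, bookkeeping] -/
theorem CkY_eq_smul_CkPY (U : CfgY 𝔸 x.toKIdx) : CkY x 𝔏 𝔢 U = ((etaDY x : ℝ) : ℂ) • CkPY x 𝔏 𝔢 U := by
  rw [CkPY_apply, smul_smul, mul_inv_cancel₀ (etaDY_coe_ne_zero x), one_smul]

end PrintLetters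

end Literature.MathematicalPhysics.QuantumFieldTheory.Balaban1983to89.Node00

end
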